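import Mathlib
import Literature.Computability.QuantumComplexity.Forrelation
import Literature.Computability.QuantumComplexity.CubicForrelation
import Literature.Computability.QuantumComplexity.ForrelationDerivativeTables
import Literature.Computability.QuantumComplexity.SignedCubicForrelation
import Summits.QuantumAdvantage.QuantumAdvantage.Theses.CubicForrelation

/-!
# Sketch — crux-ideate stmt-QuantumAdvantage-13933 (`SignedCubicForrelationInPrBPP`), ideator k = 1, round 1

First lemmas of the crux idea cards (STATEMENTS ONLY; they must elaborate, they are not proved here):

* card `polar-radical-seeds`  — `SeedLemma` (abstract linear algebra over `ZMod 2`) and its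
  Boolean reading `SeedLemmaBool`;
* card `seed-to-sign`          — `ForwardSign` (the sign of `Φ` from the M-subspace alone, no inversion
  of the hidden permutation) and `PingPong` (Walsh supports of first derivatives alternate between the
  two M-subspaces of an exact pair);
* card `decode-after-structure` — `JuntaTransparency` (polar forms at directions annihilating a junta
  of linear forms do not see the junta).

Crux decl: `Summit.QuantumAdvantage.QuantumAdvantage.Theses.CubicForrelation.SignedCubicForrelationInPrBPP`.
-/

open Literature.Computability.QuantumComplexity Finset
open Literature.Computability.QuantumComplexity.BuzetChailloux (bxor zeroVec)

set_option linter.dupNamespace false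

namespace Summit.QuantumAdvantage.QuantumAdvantage.Cruxes.SignedCubicForrelationInPrBPP.IdeatorK1

/-! ## Card `polar-radical-seeds` -/

section SeedLemma

/-- **Seed lemma (abstract form).** Let `T` be a trilinear form on `𝔽₂ⁿ` which is symmetric and
alternating in the sense `T u u w = 0` (the third-derivative form `T(u,v,w) = D_u D_v D_w a` of a cubic
Boolean function `a` is of this kind), and let `E ≤ 𝔽₂ⁿ` be a subspace with `2 · dim E ≥ n` on which
`T` is *isotropic*: `T e e' w = 0` for all `e e' ∈ E` and all `w` (for the third-derivative form:
`a` is affine on every coset of `E` — an M-subspace; `dim E = n/2` for Maiorana–McFarland bent `a`).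
Then EVERY first polar `T(κ, ·, ·)` has a non-zero vector of `E` in its radical.
(Proof, 5 lines: `v ↦ T(κ, v, ·)` maps `E` into the annihilator of `κ mod E` inside `(𝔽₂ⁿ/E)^*`,
whose dimension is `< dim E` unless `κ ∈ E`, in which case `v := κ` works.) -/
def SeedLemma : Prop :=
  ∀ (n : ℕ) (T : (Fin n → ZMod 2) →ₗ[ZMod 2] (Fin n → ZMod 2) →ₗ[ZMod 2] (Fin n → ZMod 2) →ₗ[ZMod 2] ZMod 2)
    (E : Submodule (ZMod 2) (Fin n → ZMod 2)),
    (∀ u v w, T u v w = T v u w) → (∀ u v w, T u v w = T u w v) → (∀ u w, T u u w = 0) →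
    (∀ e ∈ E, ∀ e' ∈ E, ∀ w, T e e' w = 0) →
    n ≤ 2 * Module.finrank (ZMod 2) E → 0 < Module.finrank (ZMod 2) E →
    ∀ κ : Fin n → ZMod 2, ∃ v ∈ E, v ≠ 0 ∧ ∀ w, T κ v w = 0

/-- The third derivative `D_u D_v D_w f (0)` of a Boolean function (for `f` of algebraic degree `≤ 3`
this is the value of its symmetric trilinear form, independent of the base point). -/
def thirdDeriv {n : ℕ} (f : (Fin n → Bool) → Bool) (u v w : Fin n → Bool) : Bool :=
  xor (xor (xor (f zeroVec) (f u)) (xor (f v) (f w)))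
    (xor (xor (f (bxor u v)) (f (bxor u w))) (xor (f (bxor v w)) (f (bxor (bxor u v) w))))

/-- **Seed lemma (Boolean reading, the form the decider uses).** `f` cubic, `E` a set of vectors closed
under `⊕` and containing `0` with `|E|² ≥ 2ⁿ` (a subspace of dimension `≥ n/2`), all second
derivatives of `f` along `E` having zero cubic part (`thirdDeriv f e e' w = false`): then for every
direction `κ` some non-zero `v ∈ E` lies in the radical of the polar form `thirdDeriv f κ · ·`. -/
def SeedLemmaBool : Prop :=
  ∀ (n : ℕ) (f : (Fin n → Bool) → Bool) (E : Finset (Fin n → Bool)),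
    IsDegLeFun 3 f → zeroVec ∈ E → (∀ e ∈ E, ∀ e' ∈ E, bxor e e' ∈ E) → 2 ^ n ≤ E.card ^ 2 →
    2 ≤ E.card → (∀ e ∈ E, ∀ e' ∈ E, ∀ w, thirdDeriv f e e' w = false) →
    ∀ κ : Fin n → Bool, ∃ v ∈ E, v ≠ zeroVec ∧ ∀ w, thirdDeriv f κ v w = false

end SeedLemma

/-! ## Card `seed-to-sign` -/

/-- **Forward sign formula.** For an EXACTLY forrelated pair (`Φ² = 1`) and an M-subspace `E` of `g`
of dimension `n/2` (`g` affine on every coset of `E`; exists iff `g` is in the completed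
Maiorana–McFarland class, Dillon), the sign of `Φ` is read off WITHOUT inverting the hidden
permutation: pick any `x⋆` whose character agrees on `E` with the linear part of `g|_E`
(`(-1)^{x⋆·e} = (-1)^{g(e)+g(0)}`, a linear system); then `Φ(f,g) = (-1)^{f(x⋆) + g(0)}`.
(Poisson summation over the cosets of `E` + bijectivity of the coset ↦ linear-part map, which is
forced by `|W_g| ≡ 2^{n/2}`.) Breaks the `g ↦ ¬g` symmetry explicitly (Disproof.lean §3a). -/
def ForwardSign : Prop :=
  ∀ (n : ℕ) (f g : (Fin n → Bool) → Bool) (E : Finset (Fin n → Bool)) (xstar : Fin n → Bool),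
    forrelation f g ^ 2 = 1 → zeroVec ∈ E → (∀ e ∈ E, ∀ e' ∈ E, bxor e e' ∈ E) →
    E.card ^ 2 = 2 ^ n →
    (∀ z, ∀ e ∈ E, ∀ e' ∈ E,
      g (bxor z (bxor e e')) = xor (xor (g (bxor z e)) (g (bxor z e'))) (g z)) →
    (∀ e ∈ E, twist xstar e = signOf (g e) * signOf (g zeroVec)) →
    forrelation f g = signOf (f xstar) * signOf (g zeroVec)

/-- **Ping-pong lemma.** In the situation of `ForwardSign`, `E^⊥ = {ξ : ξ·e = 0 ∀ e ∈ E}` is an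
M-subspace of `f` (duality), and for every `ξ ∈ E^⊥` the derivative `D_ξ f` is invariant under
`E^⊥`, so its Walsh transform — the row `T_f(ξ, ·)` of the landed derivative Walsh table — is
supported INSIDE `E`: one vector of `E^⊥` hands over an affine subspace of `E` (of dimension the rank
of the quadratic `D_ξ f`), and symmetrically. -/
def PingPong : Prop :=
  ∀ (n : ℕ) (f g : (Fin n → Bool) → Bool) (E : Finset (Fin n → Bool)),
    forrelation f g ^ 2 = 1 → zeroVec ∈ E → (∀ e ∈ E, ∀ e' ∈ E, bxor e e' ∈ E) →
    E.card ^ 2 = 2 ^ n →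
    (∀ z, ∀ e ∈ E, ∀ e' ∈ E,
      g (bxor z (bxor e e')) = xor (xor (g (bxor z e)) (g (bxor z e'))) (g z)) →
    ∀ ξ : Fin n → Bool, (∀ e ∈ E, twist ξ e = 1) →
      ∀ u : Fin n → Bool, u ∉ E → DerivativeWalsh.dwt (fun x => signOf (f x)) ξ u = 0

/-- **Partial-subspace sign formula** (robust form of `ForwardSign`, used when only a subspace
`F ⊆ E` of co-dimension `t` inside `E` has been found): with `w` matched to the linear part of `g`
on the coset `v ⊕ F`, Poisson summation gives
`2^{n/2} · Φ · Σ_{x ∈ w ⊕ F^⊥} (-1)^{f(x) + v·x} = |F^⊥| · Σ_{y ∈ v ⊕ F} (-1)^{g(y) + w·y}`,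
the right side an explicit `±|F|` (affine summand) and the left a sum of `|F^⊥| = 2^{n/2+t}` signs
with relative bias `2^{-t}` — so for `t = O(log n)` its sign is estimated by sampling. Stated here as
the exact Poisson identity for `Φ² = 1` (valid for ANY subspace `F`; affineness of `g` on `v ⊕ F` is
what makes the right side an explicit signed power of two). -/
def PartialSign : Prop :=
  ∀ (n : ℕ) (f g : (Fin n → Bool) → Bool) (F : Finset (Fin n → Bool)) (v w : Fin n → Bool),
    forrelation f g ^ 2 = 1 → zeroVec ∈ F → (∀ e ∈ F, ∀ e' ∈ F, bxor e e' ∈ F) →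
    Real.sqrt (2 ^ n) * forrelation f g * twist v w *
        ∑ x ∈ univ.filter (fun x => ∀ e ∈ F, twist (bxor x w) e = 1),
          signOf (f x) * twist v x =
      ((univ.filter (fun x : Fin n → Bool => ∀ e ∈ F, twist x e = 1)).card : ℝ) *
        ∑ y ∈ F.image (bxor v), signOf (g y) * twist w y

/-! ## Card `decode-after-structure` -/

/-- **Junta transparency of polar forms.** If `e` depends only on the values of linear forms
`ℓ₁,…,ℓ_t` (a junta of linear forms — the Kasami–Tokura shape of Reed–Muller words of weight
`< 2·d_min`, hence of the perturbation `a ⊕ a₀` of a promise instance around its nearest exact pair,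
granted `CubicStability`) and `κ` lies in the common kernel of the `ℓᵢ`, then the polar form of
`a ⊕ e` at `κ` equals that of `a`: seeds of the exact pair's M-subspace survive in the noisy
instance at a `2^{-t}` fraction of directions `κ`. -/
def JuntaTransparency : Prop :=
  ∀ (n t : ℕ) (a : (Fin n → Bool) → Bool) (ℓ : Fin t → (Fin n → Bool))
    (E : (Fin t → Bool) → Bool) (κ : Fin n → Bool),
    (∀ i, twist κ (ℓ i) = 1) →
    ∀ v w, thirdDeriv (fun x => xor (a x) (E fun i => decide (twist x (ℓ i) = -1))) κ v w =
      thirdDeriv a κ v w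

/-! ## Sanity: the crux by name (what a skeleton's composition theorem must conclude) -/

/-- The crux's promise problem, inline (verbatim from the route file). -/
def signedCubicForrelationProblemInline : Literature.Computability.Complexity.PromiseProblem :=
  ⟨KForrelationInstance.encode '' {I | I.IsYes ∧ I.k = 2 ∧ Even I.n ∧ ∀ i, IsDegLeFun 3 (I.C i).eval},
   KForrelationInstance.encode ''
     {I | (I.IsOverB2 ∧ I.value ≤ -(3 / 5 : ℝ)) ∧ I.k = 2 ∧ Even I.n ∧ ∀ i, IsDegLeFun 3 (I.C i).eval}⟩

example : Summit.QuantumAdvantage.QuantumAdvantage.Theses.CubicForrelation.SignedCubicForrelationInPrBPP =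
    (signedCubicForrelationProblemInline ∈ Literature.Computability.Complexity.PromiseBPP') := rfl

/-- … and it is the tree's `signedCubicForrelationProblem 2` (Disproof.lean `crux_eq`). -/
example : Summit.QuantumAdvantage.QuantumAdvantage.Theses.CubicForrelation.SignedCubicForrelationInPrBPP =
    (signedCubicForrelationProblem 2 ∈ Literature.Computability.Complexity.PromiseBPP') := rfl

end Summit.QuantumAdvantage.QuantumAdvantage.Cruxes.SignedCubicForrelationInPrBPP.IdeatorK1
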